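import Summits.ResolutionOfSingularities.ResolutionOfSingularities.Theorems.FrobeniusLadderFInjectiveMacaulayficationLx3p3Specimen
import Summits.ResolutionOfSingularities.ResolutionOfSingularities.Theorems.FrobeniusLadderFInjectiveMacaulayficationPointFloorNotFullOfFedder
import Summits.ResolutionOfSingularities.ResolutionOfSingularities.Theorems.FrobeniusLadderFInjectiveMacaulayficationP3d4z4557PointFloor
import HarnessLib

/-!
# BED T: THE POINT FLOOR OF lx3p3 = `z² + x⁴z + y⁴ + u⁴ + t⁵` (char 3): LEGAL (admissible, CM) ∧ NOT FULL, for EVERY blowing up — the INPUT HALF of the second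
# characteristic-3 row of the F-half census
# (crux `FInjectiveMacaulayfication` stmt-ResolutionOfSingularities-15315, chain w45a; res-L1-w45a-plan-1 RULINGs R21.38 (2) / R21.39 (2) «BED T by cells; stub-3 assembles the row»;
# = ONE application each of this seat's generic ✓p651649 `PointFloorLegalOfIsolated.pointFloor_input_legal` and ✓p652060 `PointFloorNotFullOfFedder.pointFloor_not_full`
# to the bed of `Lx3p3Specimen` (res-L1-w45a-stub-1 g12); seat res-L1-w45a-stub-3 g11; twin of ✓p653916 `P3d4z4557PointFloor`)

[OURS · L1 W4.5a] Support file (`--supports stmt-ResolutionOfSingularities-15315 --as helper`); def-free; §1–§2 UNCONDITIONAL; §3 instantiates the two CANDIDATE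
statements `TowerTerminates` / `LocalFInjectivizationFibreAdmGe4` taken as hypotheses (their binders met here by name at `(d,p) = (4,3)`). NOT a statement of any
manuscript; AI-written (AI review is weaker than expert review).

`X 0 = x`, `X 1 = y`, `X 2 = u`, `X 3 = t`, `X 4 = z`; `f = z² + x⁴z + y⁴ + u⁴ + t⁵` (multiplicity 2 at the origin), `v` = the vertex, floor = the POINT floor `𝔪̃`.
* §1 `theta` (the five chart identities `θᵢ f = Xᵢ² · gᵢ`), `g_not_mem_span_X`, `constantCoeff_g_zero`, ★ `g_zero_sq_mem_bracket` — the Fedder certificate of the `x`-chart: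
  `g_x = z² + x³z + x²(y⁴ + u⁴) + x³t⁵` has `g_x² = z³·z + s·(2z² + s)`, `s = x³(z + t⁵) + y³(x²y) + u³(x²u) ∈ 𝔫^[3]`, so `g_x² ∈ 𝔫^[3] = (X0³,…,X4³)` — the origin of
  the `x`-chart (a closed point over `v`) is NOT F-pure; `f_sq_mem_bracket` / `lx3p3_vertex_not_fullCl` (the vertex itself is NOT FULL: `f² ∈ 𝔪^[3]`);
  `ringKrullDim_stalk_vertex` (`dim 𝒪_{X,v} = 4`).
* §2 ★★ `pointFloor_lx3p3_input_legal` (legal: `I ≠ ⊥`, Sing-supported, `S′` regular off the closed fibre, CM everywhere) and ★★ `pointFloor_lx3p3_not_full`, for EVERY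
  blowing up `g : S′ → Spec 𝒪_{X,v}` along the point floor; `not_recipeTowerFull_zero`.
* §3 `recipeTowerFull_of_towerTerminates`, `fHalf_at_pointFloor` (candidates instantiated by name).
[cite: Fedder1983, Prop. 1.7] [cite: GortzWedhorn2020, Prop. 13.91 (2)] [cite: StacksProject, Tag 02OS; Tag 01J7] [cite: Temkin2008, §2.1] [cite: Matsumura1987, Thm. 13.5]
-/

-- single-problem summit: the doubled namespace component is forced
set_option linter.dupNamespace false

noncomputable section

namespace Summit.ResolutionOfSingularities.ResolutionOfSingularities.Theorems.FInjectiveMacaulayfication.Lx3p3PointFloor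

open CategoryTheory CategoryTheory.Limits AlgebraicGeometry TopologicalSpace IsLocalRing MvPolynomial
open Literature.AlgebraicGeometry.Resolution
open Summit.ResolutionOfSingularities.ResolutionOfSingularities.Theorems.FInjectiveMacaulayfication
open SliceableCentre GermOfGlobalBlowup

variable (k : Type) [Field k]

/-! ## §1 The strict transforms and the Fedder certificate of the `x`-chart -/

/-- ★ **The chart identities** `θᵢ f = Xᵢ² · gᵢ` for the point blow-up substitutions `θᵢ : Xⱼ ↦ XⱼXᵢ (j ≠ i), Xᵢ ↦ Xᵢ` (multiplicity `2`). [folklore] -/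
theorem theta (f : MvPolynomial (Fin 5) k) (hf : f = X 4 ^ 2 + X 0 ^ 4 * X 4 + X 1 ^ 4 + X 2 ^ 4 + X 3 ^ 5) :
    ∀ i : Fin 5, aeval (fun j : Fin 5 => if j = i then (X i : MvPolynomial (Fin 5) k) else X j * X i) f =
      X i ^ ((fun _ : Fin 5 => 2) i) * (![X 4 ^ 2 + X 0 ^ 3 * X 4 + X 0 ^ 2 * X 1 ^ 4 + X 0 ^ 2 * X 2 ^ 4 + X 0 ^ 3 * X 3 ^ 5,
        X 4 ^ 2 + X 0 ^ 4 * X 1 ^ 3 * X 4 + X 1 ^ 2 + X 1 ^ 2 * X 2 ^ 4 + X 1 ^ 3 * X 3 ^ 5,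
        X 4 ^ 2 + X 0 ^ 4 * X 2 ^ 3 * X 4 + X 1 ^ 4 * X 2 ^ 2 + X 2 ^ 2 + X 2 ^ 3 * X 3 ^ 5,
        X 4 ^ 2 + X 0 ^ 4 * X 3 ^ 3 * X 4 + X 1 ^ 4 * X 3 ^ 2 + X 2 ^ 4 * X 3 ^ 2 + X 3 ^ 3,
        1 + X 0 ^ 4 * X 4 ^ 3 + X 1 ^ 4 * X 4 ^ 2 + X 2 ^ 4 * X 4 ^ 2 + X 3 ^ 5 * X 4 ^ 3] : Fin 5 → MvPolynomial (Fin 5) k) i := by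
  intro i
  subst hf
  fin_cases i <;> simp <;> ring

/-- `f ∉ (Xᵢ)` for every `i`, in the `∀`-form of the generic lemmas (`Lx3p3Specimen.f_not_mem_span_X`). [folklore] -/
theorem f_not_mem_span_X (f : MvPolynomial (Fin 5) k) (hf : f = X 4 ^ 2 + X 0 ^ 4 * X 4 + X 1 ^ 4 + X 2 ^ 4 + X 3 ^ 5) :
    ∀ i : Fin 5, f ∉ Ideal.span {(X i : MvPolynomial (Fin 5) k)} :=
  fun i => Lx3p3Specimen.f_not_mem_span_X k f hf i

/-- `gᵢ ∉ (Xᵢ)` for every `i`: evaluate at `e_z` (`gᵢ = 1` there, `i ≤ 3`) resp. at `0` (`g_z(0) = 1`). [folklore] -/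
theorem g_not_mem_span_X :
    ∀ i : Fin 5, (![X 4 ^ 2 + X 0 ^ 3 * X 4 + X 0 ^ 2 * X 1 ^ 4 + X 0 ^ 2 * X 2 ^ 4 + X 0 ^ 3 * X 3 ^ 5,
        X 4 ^ 2 + X 0 ^ 4 * X 1 ^ 3 * X 4 + X 1 ^ 2 + X 1 ^ 2 * X 2 ^ 4 + X 1 ^ 3 * X 3 ^ 5,
        X 4 ^ 2 + X 0 ^ 4 * X 2 ^ 3 * X 4 + X 1 ^ 4 * X 2 ^ 2 + X 2 ^ 2 + X 2 ^ 3 * X 3 ^ 5,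
        X 4 ^ 2 + X 0 ^ 4 * X 3 ^ 3 * X 4 + X 1 ^ 4 * X 3 ^ 2 + X 2 ^ 4 * X 3 ^ 2 + X 3 ^ 3,
        1 + X 0 ^ 4 * X 4 ^ 3 + X 1 ^ 4 * X 4 ^ 2 + X 2 ^ 4 * X 4 ^ 2 + X 3 ^ 5 * X 4 ^ 3] : Fin 5 → MvPolynomial (Fin 5) k) i ∉ Ideal.span {(X i : MvPolynomial (Fin 5) k)} := by
  intro i h
  rw [Ideal.mem_span_singleton] at h
  obtain ⟨c, hc⟩ := h
  fin_cases i
  · have := congrArg (MvPolynomial.eval (Pi.single 4 1 : Fin 5 → k)) hc; simp at this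
  · have := congrArg (MvPolynomial.eval (Pi.single 4 1 : Fin 5 → k)) hc; simp at this
  · have := congrArg (MvPolynomial.eval (Pi.single 4 1 : Fin 5 → k)) hc; simp at this
  · have := congrArg (MvPolynomial.eval (Pi.single 4 1 : Fin 5 → k)) hc; simp at this
  · have := congrArg (MvPolynomial.eval (0 : Fin 5 → k)) hc; simp at this

/-- `g_x` has no constant term. [plumbing] -/
theorem constantCoeff_g_zero : constantCoeff ((![X 4 ^ 2 + X 0 ^ 3 * X 4 + X 0 ^ 2 * X 1 ^ 4 + X 0 ^ 2 * X 2 ^ 4 + X 0 ^ 3 * X 3 ^ 5,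
        X 4 ^ 2 + X 0 ^ 4 * X 1 ^ 3 * X 4 + X 1 ^ 2 + X 1 ^ 2 * X 2 ^ 4 + X 1 ^ 3 * X 3 ^ 5,
        X 4 ^ 2 + X 0 ^ 4 * X 2 ^ 3 * X 4 + X 1 ^ 4 * X 2 ^ 2 + X 2 ^ 2 + X 2 ^ 3 * X 3 ^ 5,
        X 4 ^ 2 + X 0 ^ 4 * X 3 ^ 3 * X 4 + X 1 ^ 4 * X 3 ^ 2 + X 2 ^ 4 * X 3 ^ 2 + X 3 ^ 3,
        1 + X 0 ^ 4 * X 4 ^ 3 + X 1 ^ 4 * X 4 ^ 2 + X 2 ^ 4 * X 4 ^ 2 + X 3 ^ 5 * X 4 ^ 3] : Fin 5 → MvPolynomial (Fin 5) k) 0) = 0 := by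
  simp [constantCoeff_X]

/-- ★ **The Fedder certificate of the `x`-chart**: `g_x² ∈ 𝔫^{[3]} = (X0³, …, X4³)`, via the explicit decomposition `g_x² = z³·z + s·(2z² + s)` with
`s = x³(z + t⁵) + y³(x²y) + u³(x²u)` (`g_x = z² + s`). [certificate; cite: Fedder1983, Prop. 1.7] -/
theorem g_zero_sq_mem_bracket :
    ((![X 4 ^ 2 + X 0 ^ 3 * X 4 + X 0 ^ 2 * X 1 ^ 4 + X 0 ^ 2 * X 2 ^ 4 + X 0 ^ 3 * X 3 ^ 5,
        X 4 ^ 2 + X 0 ^ 4 * X 1 ^ 3 * X 4 + X 1 ^ 2 + X 1 ^ 2 * X 2 ^ 4 + X 1 ^ 3 * X 3 ^ 5,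
        X 4 ^ 2 + X 0 ^ 4 * X 2 ^ 3 * X 4 + X 1 ^ 4 * X 2 ^ 2 + X 2 ^ 2 + X 2 ^ 3 * X 3 ^ 5,
        X 4 ^ 2 + X 0 ^ 4 * X 3 ^ 3 * X 4 + X 1 ^ 4 * X 3 ^ 2 + X 2 ^ 4 * X 3 ^ 2 + X 3 ^ 3,
        1 + X 0 ^ 4 * X 4 ^ 3 + X 1 ^ 4 * X 4 ^ 2 + X 2 ^ 4 * X 4 ^ 2 + X 3 ^ 5 * X 4 ^ 3] : Fin 5 → MvPolynomial (Fin 5) k) 0) ^ (3 - 1) ∈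
      Ideal.span (Set.range fun i : Fin 5 => (X i : MvPolynomial (Fin 5) k) ^ 3) := by
  have hcu : ∀ j : Fin 5, (X j : MvPolynomial (Fin 5) k) ^ 3 ∈ Ideal.span (Set.range fun i : Fin 5 => (X i : MvPolynomial (Fin 5) k) ^ 3) :=
    fun j => Ideal.subset_span ⟨j, rfl⟩
  change (X 4 ^ 2 + X 0 ^ 3 * X 4 + X 0 ^ 2 * X 1 ^ 4 + X 0 ^ 2 * X 2 ^ 4 + X 0 ^ 3 * X 3 ^ 5 : MvPolynomial (Fin 5) k) ^ (3 - 1) ∈ _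
  have e : (X 4 ^ 2 + X 0 ^ 3 * X 4 + X 0 ^ 2 * X 1 ^ 4 + X 0 ^ 2 * X 2 ^ 4 + X 0 ^ 3 * X 3 ^ 5 : MvPolynomial (Fin 5) k) ^ (3 - 1) =
      X 4 ^ 3 * X 4 +
      (X 0 ^ 3 * (X 4 + X 3 ^ 5) + X 1 ^ 3 * (X 0 ^ 2 * X 1) + X 2 ^ 3 * (X 0 ^ 2 * X 2)) *
        (2 * X 4 ^ 2 + (X 0 ^ 3 * X 4 + X 0 ^ 2 * X 1 ^ 4 + X 0 ^ 2 * X 2 ^ 4 + X 0 ^ 3 * X 3 ^ 5)) := by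
    rw [show (3 - 1 : ℕ) = 2 from rfl]
    ring
  rw [e]
  exact Ideal.add_mem _ (Ideal.mul_mem_right _ _ (hcu 4))
    (Ideal.mul_mem_right _ _ (Ideal.add_mem _ (Ideal.add_mem _ (Ideal.mul_mem_right _ _ (hcu 0)) (Ideal.mul_mem_right _ _ (hcu 1)))
      (Ideal.mul_mem_right _ _ (hcu 2))))

/-- `f² ∈ 𝔪^{[3]} = (x³, y³, u³, t³, z³)`: `f = z² + r` with `r = x⁴z + y⁴ + u⁴ + t⁵ ∈ 𝔪^{[3]}`, so `f² = z³·z + r·(2z² + r)`. [certificate; cite: Fedder1983, Prop. 1.7] -/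
theorem f_sq_mem_bracket (f : MvPolynomial (Fin 5) k) (hf : f = X 4 ^ 2 + X 0 ^ 4 * X 4 + X 1 ^ 4 + X 2 ^ 4 + X 3 ^ 5) :
    f ^ (3 - 1) ∈ Ideal.span (Set.range fun i : Fin 5 => (X i : MvPolynomial (Fin 5) k) ^ 3) := by
  have hcu : ∀ j : Fin 5, (X j : MvPolynomial (Fin 5) k) ^ 3 ∈ Ideal.span (Set.range fun i : Fin 5 => (X i : MvPolynomial (Fin 5) k) ^ 3) :=
    fun j => Ideal.subset_span ⟨j, rfl⟩
  have e : f ^ (3 - 1) = X 4 ^ 3 * X 4 +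
      (X 0 ^ 3 * (X 0 * X 4) + X 1 ^ 3 * X 1 + X 2 ^ 3 * X 2 + X 3 ^ 3 * X 3 ^ 2) * (2 * X 4 ^ 2 + (X 0 ^ 4 * X 4 + X 1 ^ 4 + X 2 ^ 4 + X 3 ^ 5)) := by
    rw [hf, show (3 - 1 : ℕ) = 2 from rfl]
    ring
  rw [e]
  exact Ideal.add_mem _ (Ideal.mul_mem_right _ _ (hcu 4))
    (Ideal.mul_mem_right _ _ (Ideal.add_mem _ (Ideal.add_mem _ (Ideal.add_mem _ (Ideal.mul_mem_right _ _ (hcu 0)) (Ideal.mul_mem_right _ _ (hcu 1)))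
      (Ideal.mul_mem_right _ _ (hcu 2))) (Ideal.mul_mem_right _ _ (hcu 3))))

/-- ★ **The vertex of BED T is NOT FULL**: `f² ∈ 𝔪^{[3]}` (Fedder necessity, `HypersurfaceOriginNotFull.not_fullCl_stalk_origin_of_fedder_mem` at `p = 3`).
[cite: Fedder1983, Prop. 1.7] -/
theorem lx3p3_vertex_not_fullCl [CharP k 3] (f : MvPolynomial (Fin 5) k) (hf : f = X 4 ^ 2 + X 0 ^ 4 * X 4 + X 1 ^ 4 + X 2 ^ 4 + X 3 ^ 5)
    (v : Spec (.of (MvPolynomial (Fin 5) k ⧸ Ideal.span {f})))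
    (hv : v.asIdeal = Ideal.span (Set.range (fun j : Fin 5 => Ideal.Quotient.mk (Ideal.span {f}) (X j)))) :
    ¬ FullCl 3 ((Spec (.of (MvPolynomial (Fin 5) k ⧸ Ideal.span {f}))).presheaf.stalk v) := by
  haveI : Fact (Nat.Prime 3) := ⟨Nat.prime_three⟩
  exact HypersurfaceOriginNotFull.not_fullCl_stalk_origin_of_fedder_mem 3 k f (Lx3p3Specimen.prime_f k f hf).ne_zero (Lx3p3Specimen.constantCoeff_f k f hf)
    (f_sq_mem_bracket k f hf) v hv

/-- (H3) `dim 𝒪_{X,v} = 4`. [cite: Matsumura1987, Thm. 13.5] -/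
theorem ringKrullDim_stalk_vertex [CharP k 3] (f : MvPolynomial (Fin 5) k) (hf : f = X 4 ^ 2 + X 0 ^ 4 * X 4 + X 1 ^ 4 + X 2 ^ 4 + X 3 ^ 5)
    (v : Spec (.of (MvPolynomial (Fin 5) k ⧸ Ideal.span {f})))
    (hv : v.asIdeal = Ideal.span (Set.range (fun j : Fin 5 => Ideal.Quotient.mk (Ideal.span {f}) (X j)))) :
    ringKrullDim ((Spec (.of (MvPolynomial (Fin 5) k ⧸ Ideal.span {f}))).presheaf.stalk v) = (4 : ℕ) := by
  haveI : v.asIdeal.IsMaximal := by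
    rw [hv]
    exact DoublePointFermatCubicGerm.isMaximal_origin k f (Lx3p3Specimen.constantCoeff_f k f hf)
  rw [ringKrullDim_stalk_Spec_eq]
  exact HypersurfaceLocalDim.stub_hypersurfaceLocalDim k 4 f (Lx3p3Specimen.prime_f k f hf).ne_zero v.asIdeal

/-! ## §2 For EVERY blowing up along the point floor: legal ∧ not FULL -/

/-- ★★ **THE POINT FLOOR OF BED T IS A LEGAL INPUT** of `TowerTerminates` / the F-half: for every blowing up `g : S′ → Spec 𝒪_{X,v}` along `I = 𝔪̃|_{Spec 𝒪_{X,v}}`: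
(1) `I ≠ ⊥`; (2) `Supp I ⊆ (Reg Spec 𝒪_{X,v})ᶜ`; (3) `S′` is regular off the closed fibre; (4) `S′` satisfies the CM clause at every point — ONE application of the generic
`PointFloorLegalOfIsolated.pointFloor_input_legal`. [folklore assembly; cite: GortzWedhorn2020, Prop. 13.91 (2)] [cite: StacksProject, Tag 02OS; Tag 01J7] [cite: Temkin2008, §2.1] -/
theorem pointFloor_lx3p3_input_legal [CharP k 3] (f : MvPolynomial (Fin 5) k) (hf : f = X 4 ^ 2 + X 0 ^ 4 * X 4 + X 1 ^ 4 + X 2 ^ 4 + X 3 ^ 5)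
    (v : Spec (.of (MvPolynomial (Fin 5) k ⧸ Ideal.span {f})))
    (hv : v.asIdeal = Ideal.span (Set.range (fun j : Fin 5 => Ideal.Quotient.mk (Ideal.span {f}) (X j))))
    (S' : Scheme.{0}) (g : S' ⟶ Spec ((Spec (.of (MvPolynomial (Fin 5) k ⧸ Ideal.span {f}))).presheaf.stalk v))
    (hg : IsBlowup g ((affineBlowup.idealSheaf (Ideal.span (Set.range (fun j : Fin 5 => Ideal.Quotient.mk (Ideal.span {f}) (X j))))).comap ((Spec (.of (MvPolynomial (Fin 5) k ⧸ Ideal.span {f}))).fromSpecStalk v))) :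
    ((affineBlowup.idealSheaf (Ideal.span (Set.range (fun j : Fin 5 => Ideal.Quotient.mk (Ideal.span {f}) (X j))))).comap ((Spec (.of (MvPolynomial (Fin 5) k ⧸ Ideal.span {f}))).fromSpecStalk v)) ≠ ⊥ ∧
    (((((affineBlowup.idealSheaf (Ideal.span (Set.range (fun j : Fin 5 => Ideal.Quotient.mk (Ideal.span {f}) (X j))))).comap ((Spec (.of (MvPolynomial (Fin 5) k ⧸ Ideal.span {f}))).fromSpecStalk v))).support : Set (Spec ((Spec (.of (MvPolynomial (Fin 5) k ⧸ Ideal.span {f}))).presheaf.stalk v))) ⊆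
      (Scheme.regularLocus (Spec ((Spec (.of (MvPolynomial (Fin 5) k ⧸ Ideal.span {f}))).presheaf.stalk v)))ᶜ) ∧
    (∀ s : S', g.base s ≠ closedPoint ((Spec (.of (MvPolynomial (Fin 5) k ⧸ Ideal.span {f}))).presheaf.stalk v) → s ∈ Scheme.regularLocus S') ∧
    (∀ s : S', CMCl (S'.presheaf.stalk s)) :=
  PointFloorLegalOfIsolated.pointFloor_input_legal k f (Lx3p3Specimen.prime_f k f hf) (by norm_num) (fun _ : Fin 5 => 2) _ (theta k f hf)
    (f_not_mem_span_X k f hf) (g_not_mem_span_X k) v hv (Lx3p3Specimen.vertex_not_mem_regularLocus k f hf v hv)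
    (Lx3p3Specimen.regular_of_ne_vertex k f hf v hv) S' g hg

/-- ★★ **THE POINT FLOOR OF BED T IS NOT FULL**: for every blowing up `g : S′ → Spec 𝒪_{X,v}` along `I` there is a point `s ∈ S′` over the closed point whose local
ring is NOT `FullCl 3` (the origin of the chart `D(x̄)`, Fedder certificate `g_zero_sq_mem_bracket`) — ONE application of the generic `PointFloorNotFullOfFedder.pointFloor_not_full`.
[OURS · assembly; cite: Fedder1983, Prop. 1.7; GortzWedhorn2020, Prop. 13.91 (2)] -/
theorem pointFloor_lx3p3_not_full [CharP k 3] (f : MvPolynomial (Fin 5) k) (hf : f = X 4 ^ 2 + X 0 ^ 4 * X 4 + X 1 ^ 4 + X 2 ^ 4 + X 3 ^ 5)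
    (v : Spec (.of (MvPolynomial (Fin 5) k ⧸ Ideal.span {f})))
    (hv : v.asIdeal = Ideal.span (Set.range (fun j : Fin 5 => Ideal.Quotient.mk (Ideal.span {f}) (X j))))
    (S' : Scheme.{0}) (g : S' ⟶ Spec ((Spec (.of (MvPolynomial (Fin 5) k ⧸ Ideal.span {f}))).presheaf.stalk v))
    (hg : IsBlowup g ((affineBlowup.idealSheaf (Ideal.span (Set.range (fun j : Fin 5 => Ideal.Quotient.mk (Ideal.span {f}) (X j))))).comap ((Spec (.of (MvPolynomial (Fin 5) k ⧸ Ideal.span {f}))).fromSpecStalk v))) :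
    ∃ s : S', g.base s = closedPoint ((Spec (.of (MvPolynomial (Fin 5) k ⧸ Ideal.span {f}))).presheaf.stalk v) ∧ ¬ FullCl 3 (S'.presheaf.stalk s) := by
  haveI : Fact (Nat.Prime 3) := ⟨Nat.prime_three⟩
  exact PointFloorNotFullOfFedder.pointFloor_not_full 3 k f (Lx3p3Specimen.prime_f k f hf) (fun _ : Fin 5 => 2) _ (theta k f hf)
    (f_not_mem_span_X k f hf) (g_not_mem_span_X k) (Lx3p3Specimen.constantCoeff_f k f hf) 0 (constantCoeff_g_zero k)
    (g_zero_sq_mem_bracket k) v hv S' g hg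

/-- Hence no recipe tower of height `0` from this floor: `¬ RecipeTowerFull c 3 0 S′`, for EVERY centre recipe `c`. [OURS] -/
theorem not_recipeTowerFull_zero [CharP k 3] (c : IntrinsicTower.Recipes.CentreRecipe) (f : MvPolynomial (Fin 5) k) (hf : f = X 4 ^ 2 + X 0 ^ 4 * X 4 + X 1 ^ 4 + X 2 ^ 4 + X 3 ^ 5)
    (v : Spec (.of (MvPolynomial (Fin 5) k ⧸ Ideal.span {f})))
    (hv : v.asIdeal = Ideal.span (Set.range (fun j : Fin 5 => Ideal.Quotient.mk (Ideal.span {f}) (X j))))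
    (S' : Scheme.{0}) (g : S' ⟶ Spec ((Spec (.of (MvPolynomial (Fin 5) k ⧸ Ideal.span {f}))).presheaf.stalk v))
    (hg : IsBlowup g ((affineBlowup.idealSheaf (Ideal.span (Set.range (fun j : Fin 5 => Ideal.Quotient.mk (Ideal.span {f}) (X j))))).comap ((Spec (.of (MvPolynomial (Fin 5) k ⧸ Ideal.span {f}))).fromSpecStalk v))) :
    ¬ IntrinsicTower.Recipes.RecipeTowerFull c 3 0 S' := by
  intro h0
  obtain ⟨s, -, hs⟩ := pointFloor_lx3p3_not_full k f hf v hv S' g hg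
  exact hs (IntrinsicTower.Recipes.recipeTowerFull_zero.mp h0 s)

/-! ## §3 The binders of `TowerTerminates` and of the F-half are met at this floor, BY NAME, at `(d, p) = (4, 3)` -/

/-- ★ **`TowerTerminates c`, instantiated at the point floor of BED T** (the candidate taken as a hypothesis; all its binders discharged at `(d,p) = (4,3)`): the
`c`-tower from `S′` terminates at some height `n` (`≥ 1` by §2). [OURS · instantiation of a candidate statement] -/
theorem recipeTowerFull_of_towerTerminates [CharP k 3] (c : IntrinsicTower.Recipes.CentreRecipe) (hTT : IntrinsicTower.Recipes.TowerTerminates c)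
    (f : MvPolynomial (Fin 5) k) (hf : f = X 4 ^ 2 + X 0 ^ 4 * X 4 + X 1 ^ 4 + X 2 ^ 4 + X 3 ^ 5)
    (v : Spec (.of (MvPolynomial (Fin 5) k ⧸ Ideal.span {f})))
    (hv : v.asIdeal = Ideal.span (Set.range (fun j : Fin 5 => Ideal.Quotient.mk (Ideal.span {f}) (X j))))
    (S' : Scheme.{0}) (g : S' ⟶ Spec ((Spec (.of (MvPolynomial (Fin 5) k ⧸ Ideal.span {f}))).presheaf.stalk v))
    (hg : IsBlowup g ((affineBlowup.idealSheaf (Ideal.span (Set.range (fun j : Fin 5 => Ideal.Quotient.mk (Ideal.span {f}) (X j))))).comap ((Spec (.of (MvPolynomial (Fin 5) k ⧸ Ideal.span {f}))).fromSpecStalk v))) :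
    ∃ n : ℕ, IntrinsicTower.Recipes.RecipeTowerFull c 3 n S' := by
  haveI := Lx3p3Specimen.isIntegral_lx3p3 k f hf
  obtain ⟨h1, h2, h3, h4⟩ := pointFloor_lx3p3_input_legal k f hf v hv S' g hg
  exact hTT 4 le_rfl 3 Nat.prime_three k (Spec (.of (MvPolynomial (Fin 5) k ⧸ Ideal.span {f})))
    (Spec.map (CommRingCat.ofHom (algebraMap k (MvPolynomial (Fin 5) k ⧸ Ideal.span {f}))))
    (FermatCubicConeGerm.structureMorphism_isSeparated k f) (FermatCubicConeGerm.structureMorphism_locallyOfFiniteType k f)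
    (FermatCubicConeGerm.structureMorphism_quasiCompact k f) inferInstance v (Lx3p3Specimen.isClosed_vertex k f hf v hv)
    (Lx3p3Specimen.vertex_not_mem_regularLocus k f hf v hv) (ringKrullDim_stalk_vertex k f hf v hv) S' g _ h1 h2 hg h3 h4

/-- ★ **The candidate F-half `LocalFInjectivizationFibreAdmGe4` (taken as a hypothesis), instantiated at the point floor of BED T, `(d, p) = (4, 3)`.**
Its conclusion is discharged UNCONDITIONALLY by `Lx3p3PointFloorRow.pointFloor_lx3p3_row` (the `𝔪·K` certificate). [OURS · instantiation of a candidate statement] -/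
theorem fHalf_at_pointFloor [CharP k 3] (h : LocalFullificationFibreAdmGe4Split.LocalFInjectivizationFibreAdmGe4) (f : MvPolynomial (Fin 5) k)
    (hf : f = X 4 ^ 2 + X 0 ^ 4 * X 4 + X 1 ^ 4 + X 2 ^ 4 + X 3 ^ 5)
    (v : Spec (.of (MvPolynomial (Fin 5) k ⧸ Ideal.span {f})))
    (hv : v.asIdeal = Ideal.span (Set.range (fun j : Fin 5 => Ideal.Quotient.mk (Ideal.span {f}) (X j))))
    (S' : Scheme.{0}) (g : S' ⟶ Spec ((Spec (.of (MvPolynomial (Fin 5) k ⧸ Ideal.span {f}))).presheaf.stalk v))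
    (hg : IsBlowup g ((affineBlowup.idealSheaf (Ideal.span (Set.range (fun j : Fin 5 => Ideal.Quotient.mk (Ideal.span {f}) (X j))))).comap ((Spec (.of (MvPolynomial (Fin 5) k ⧸ Ideal.span {f}))).fromSpecStalk v))) :
    ∃ 𝓚 : S'.IdealSheafData, 𝓚 ≠ ⊥ ∧
      (∀ s ∈ (𝓚.support : Set S'), g.base s = closedPoint ((Spec (.of (MvPolynomial (Fin 5) k ⧸ Ideal.span {f}))).presheaf.stalk v)) ∧
      ∀ (S'' : Scheme.{0}) (π : S'' ⟶ S'), IsBlowup π 𝓚 → ∀ s : S'', FullCl 3 (S''.presheaf.stalk s) := by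
  haveI := Lx3p3Specimen.isIntegral_lx3p3 k f hf
  obtain ⟨h1, h2, h3, h4⟩ := pointFloor_lx3p3_input_legal k f hf v hv S' g hg
  exact h 4 le_rfl 3 Nat.prime_three k (Spec (.of (MvPolynomial (Fin 5) k ⧸ Ideal.span {f})))
    (Spec.map (CommRingCat.ofHom (algebraMap k (MvPolynomial (Fin 5) k ⧸ Ideal.span {f}))))
    (FermatCubicConeGerm.structureMorphism_isSeparated k f) (FermatCubicConeGerm.structureMorphism_locallyOfFiniteType k f)
    (FermatCubicConeGerm.structureMorphism_quasiCompact k f) inferInstance v (Lx3p3Specimen.isClosed_vertex k f hf v hv)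
    (Lx3p3Specimen.vertex_not_mem_regularLocus k f hf v hv) (ringKrullDim_stalk_vertex k f hf v hv) S' g _ h1 h2 hg h3 h4

end Summit.ResolutionOfSingularities.ResolutionOfSingularities.Theorems.FInjectiveMacaulayfication.Lx3p3PointFloor

end
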